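import Summits.QuantumFields.BalabanUV.Beta.SpineRootedBmNRelInv
import Summits.QuantumFields.BalabanUV.Beta.WilsonReflectionContact

/-!
# `hR` for the native block-mean-dressed spine — the Wilson ff-law DISCHARGED (normalisation hyperplane `2·cVH = −cE·Lc⁴`) and the
# ASSEMBLED root: rules 3–4 at `j ≥ 1` AND the Wilson law discharged

`SpineRootedBmNReduced.axisReflectionCovariant_flipK_TbalOf_JsBalBmNAtOf_ctrC_candidate` (the `hR` root of row D1 for the co-dressed
native spine `JsBalBm♮_{ρ_c}` with the candidate bordered binder `bhKStepAt`) had four groups of hypotheses: (L1) rules 3–4 of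
`bhKStepAt (j+1)` against the co-dressed step covariance (`h3S`, `h4S`), (L2) the field–field reflection law of the Wilson table at `j = 0`
with a contact coefficient `c 0` tied to the units by `cE · c 0 = cVH / Lc⁴` (`hWff`, `hc0`), (L3) the value-function ff-laws at `j ≥ 1`
(`hE3ff`), (L4) the W-supplier's sockets (`hWt`, `X₂`, `hX₂`, `hEX₂`, `hWrC`).  (L1) is the theorem
`BorderedHessian.relInv_coDressKBmAt_KInvStep_succ_bhKStepAt` (root form `SpineRootedBmNRelInv.…_ctrC_relInv`); (L2) was PROVED by
lineage an3 with the coefficient `−½` decided by the kernel (`WilsonReflectionContact.wilsonA_bref_inl_inl_conjV`).  Consequently,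
on the hyperplane `2·cVH = −cE·Lc⁴` of the two free units (an1's finding X-an3-28-1; e.g. the `bhK` units `(cE, cVH) = (2, −Lc⁴)`):
§1 `…_ctrC_wilson` = the candidate root minus `hWff`, `hc0`, plus `hn : 2 * cVH = -(cE * Lc ^ 4)`, and its unit instance
`…_ctrC_wilson_two`; §2 `…_ctrC_assembled` = (L1) AND (L2) discharged — its hypotheses are EXACTLY (L3) and (L4) (plus the coefficient
bookkeeping `γ`, `C`, `c (j+1)`, `hn`) — and `…_ctrC_assembled_two` at `(cE, cVH) = (2, −Lc⁴)`.

STATUS OF (L3) (row-owner note, 2026-08-20): lineage an3 (gen 29, `E3LevelOneReflection`, exact toy) showed that the socket `hE3ff` is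
NOT fillable at level 1 for the family as presently defined (the third jet `e3NAtOf` is built from the straight `KInv`); the step jets
are being re-typed over the co-dressed resolvent (decision (L3-D), GAP C-an2-75).  The theorems below are correct as stated; their (L3)
hypothesis awaits that re-typing.  HONEST FRAMING: [folklore] finite-dimensional wiring; NOT D1, NOT BetaPertH, NOT the continuum limit,
NOT Clay.
-/

open Finset
open scoped BigOperators
open Literature.MathematicalPhysics.QuantumFieldTheory
open Literature.MathematicalPhysics.QuantumFieldTheory.Balaban1983to89
open Literature.MathematicalPhysics.QuantumFieldTheory.Balaban1983to89.Beta
open ExpKernelCalculus (MKer Decays BiLoc comp tr VertexFamily VertexFamily₂ shiftK)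
open AffineAveraging (Form1 Form2 box toSite)
open AveragingContoursRooted (ctr ctrOff ctrOff_mem_box)
open StepJetData (wilsonA)
open PolarizationSign (reflSign AxisReflectionCovariant)
open KernelReflection (refK)
open ResolventReflection (bref Φ Φ_r_inl Φ_s_inl)
open OneStepResolventKernel (Fib LocStencil JetData)
open OneStepKernelFamily (KInvStep vertexOfK TbalOf flipK)
open BalabanStepJetsSucc (wE wVH)
open Summit.QuantumFields.BalabanUV.Beta.TameKernelCalculus
open Summit.QuantumFields.BalabanUV.Beta.ChartConjugation (conjV conjW)
open Summit.QuantumFields.BalabanUV.Beta.AxialDressingRooted (coDressKBmAt axEc one_le_of_neZero)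
open Summit.QuantumFields.BalabanUV.Beta.BorderedHessian (bhKAt diagK ctGen bhKStepAt stepScale
  relInv_coDressKBmAt_KInvStep_succ_bhKStepAt)
open Summit.QuantumFields.BalabanUV.Beta.WilsonReflectionContact (wilsonA_bref_inl_inl_conjV)

namespace Summit.QuantumFields.BalabanUV.Beta.SpineRooted

noncomputable section

/-! ## §1 The Wilson ff-law discharged -/

/-- [folklore] **`hR` FOR THE NATIVE BLOCK-MEAN-DRESSED SPINE ON THE NORMALISATION HYPERPLANE `2·cVH = −cE·Lc⁴`** — the candidate
root `axisReflectionCovariant_flipK_TbalOf_JsBalBmNAtOf_ctrC_candidate` with its Wilson ff-law hypothesis `hWff` and the tie `hc0`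
DISCHARGED by an3's `WilsonReflectionContact.wilsonA_bref_inl_inl_conjV` (contact coefficient `−½`).  The successor coefficients
`c (j+1)` keep their role (`hcS`, `hE3ff`); `c 0` is no longer referenced. -/
theorem axisReflectionCovariant_flipK_TbalOf_JsBalBmNAtOf_ctrC_wilson {Lc : ℕ} [NeZero Lc] (hLc : Odd Lc) (cE cVH cΛ : ℝ)
    (hn : 2 * cVH = -(cE * (Lc : ℝ) ^ 4))
    (W : ℕ → Fin 4 → (Fin 4 → ℤ) → Fin 4 → (Fin 4 → ℤ) → MKer 4 (Fib 3)) (Cw δw : ℕ → ℝ) (hδw : ∀ j, 0 < δw j)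
    (hW : ∀ j, VertexFamily₂ (W j) Lc (Cw j) (δw j))
    (hWt : ∀ (j : ℕ) (μ : Fin 4) (y : Fin 4 → ℤ) (ν : Fin 4) (y' t : Fin 4 → ℤ),
      W j μ (y + t) ν (y' + t) = shiftK (-((Lc : ℤ) • t)) (W j μ y ν y'))
    (h3S : ∀ j, comp (comp (coDressKBmAt (toSite (ctrOff 4 Lc)) Lc (KInvStep (d := 3) Lc (j + 1)))
      (bhKStepAt 3 (toSite (ctrOff 4 Lc)) Lc (j + 1))) (axEc (toSite (ctrOff 4 Lc)) Lc) = axEc (toSite (ctrOff 4 Lc)) Lc)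
    (h4S : ∀ j, comp (comp (axEc (toSite (ctrOff 4 Lc)) Lc) (bhKStepAt 3 (toSite (ctrOff 4 Lc)) Lc (j + 1)))
      (coDressKBmAt (toSite (ctrOff 4 Lc)) Lc (KInvStep (d := 3) Lc (j + 1))) = axEc (toSite (ctrOff 4 Lc)) Lc)
    (γ : ℕ → ℝ) (hγ0 : γ 0 = cVH / (Lc : ℝ) ^ 4)
    (hγS : ∀ j, γ (j + 1) = cVH * wVH 3 Lc (j + 1) / (stepScale 3 Lc (j + 1) * (Lc : ℝ) ^ 4))
    (C : ℕ → Fin 4 → Fin 4 → (Fin 4 → ℤ) → MKer 4 (Fib 3)) (hCdef : ∀ j α κ' u, C j α κ' u = γ j • diagK (ctGen 3 α Lc κ' u))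
    (c : ℕ → ℝ) (hcS : ∀ j, cE * wE 3 Lc (j + 1) * c (j + 1) = γ (j + 1))
    (hE3ff : ∀ (j : ℕ) (α κ' : Fin 4) (u x z : Fin 4 → ℤ) (a b : Fin 4),
      e3NAtOf 3 Lc (toSite (ctrOff 4 Lc)) cE cVH cΛ (j + 1) κ' (bref α κ' u) x z (Sum.inl a) (Sum.inl b) =
        reflSign α κ' * ((Φ Lc α).s (Sum.inl a) * (Φ Lc α).s (Sum.inl b) *
          (e3NAtOf 3 Lc (toSite (ctrOff 4 Lc)) cE cVH cΛ (j + 1) κ' u ((Φ Lc α).r (Sum.inl a) x) ((Φ Lc α).r (Sum.inl b) z)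
              (Sum.inl a) (Sum.inl b) +
            c (j + 1) * conjV (bhKStepAt 3 (toSite (ctrOff 4 Lc)) Lc (j + 1)) (diagK (ctGen 3 α Lc κ' u))
              ((Φ Lc α).r (Sum.inl a) x) ((Φ Lc α).r (Sum.inl b) z) (Sum.inl a) (Sum.inl b))))
    (X₂ : ℕ → Fin 4 → Fin 4 → (Fin 4 → ℤ) → Fin 4 → (Fin 4 → ℤ) → MKer 4 (Fib 3)) (hX₂ : ∀ j α μ y ν y', Loc (X₂ j α μ y ν y'))
    (hEX₂ : ∀ j α μ y ν y', comp (axEc (toSite (ctrOff 4 Lc)) Lc) (X₂ j α μ y ν y') = comp (X₂ j α μ y ν y') (axEc (toSite (ctrOff 4 Lc)) Lc))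
    (hWrC : ∀ (j : ℕ) (α μ : Fin 4) (y : Fin 4 → ℤ) (ν : Fin 4) (y' : Fin 4 → ℤ),
      (JsBal0NAtOf (d := 3) hLc.pos (ctrOff_mem_box hLc.pos) cE cVH cΛ W Cw δw hδw hW j).W μ (bref α μ y) ν (bref α ν y') =
        (reflSign α μ * reflSign α ν) • refK (Φ Lc α)
          ((JsBal0NAtOf (d := 3) hLc.pos (ctrOff_mem_box hLc.pos) cE cVH cΛ W Cw δw hδw hW j).W μ y ν y' +
            conjW (bhKStepAt 3 (toSite (ctrOff 4 Lc)) Lc j)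
              (vertexOfK (coDressKBmAt (toSite (ctrOff 4 Lc)) Lc (KInvStep (d := 3) Lc j)) Lc
                (JsBal0NAtOf (d := 3) hLc.pos (ctrOff_mem_box hLc.pos) cE cVH cΛ W Cw δw hδw hW j).S μ y)
              (vertexOfK (coDressKBmAt (toSite (ctrOff 4 Lc)) Lc (KInvStep (d := 3) Lc j)) Lc
                (JsBal0NAtOf (d := 3) hLc.pos (ctrOff_mem_box hLc.pos) cE cVH cΛ W Cw δw hδw hW j).S ν y')
              (vertexOfK (coDressKBmAt (toSite (ctrOff 4 Lc)) Lc (KInvStep (d := 3) Lc j)) Lc (C j α) μ y)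
              (vertexOfK (coDressKBmAt (toSite (ctrOff 4 Lc)) Lc (KInvStep (d := 3) Lc j)) Lc (C j α) ν y') (X₂ j α μ y ν y'))) :
    ∀ j : ℕ, AxisReflectionCovariant
      (flipK (TbalOf Lc (JsBalBmNAtOf (d := 3) hLc.pos (ctrOff_mem_box hLc.pos) cE cVH cΛ W Cw δw hδw hW) j)) := by
  -- the contact coefficients with the kernel-decided `c 0 := −½`
  let c' : ℕ → ℝ := fun j => Nat.casesOn (motive := fun _ => ℝ) j (-(1 / 2) : ℝ) fun k => c (k + 1)
  have hL : ((Lc : ℝ) ^ 4) ≠ 0 := pow_ne_zero _ (by exact_mod_cast NeZero.ne Lc)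
  have hc0 : cE * c' 0 = γ 0 := by
    show cE * (-(1 / 2) : ℝ) = γ 0
    rw [hγ0, eq_div_iff hL]
    linarith
  have hcS' : ∀ j, cE * wE 3 Lc (j + 1) * c' (j + 1) = γ (j + 1) := fun j => hcS j
  have hWff : ∀ (α κ' : Fin 4) (u x z : Fin 4 → ℤ) (a b : Fin 4),
      wilsonA 3 κ' (bref α κ' u) x z (Sum.inl a) (Sum.inl b) =
        reflSign α κ' * ((Φ Lc α).s (Sum.inl a) * (Φ Lc α).s (Sum.inl b) *
          (wilsonA 3 κ' u ((Φ Lc α).r (Sum.inl a) x) ((Φ Lc α).r (Sum.inl b) z) (Sum.inl a) (Sum.inl b) +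
            c' 0 * conjV (bhKAt 3 (toSite (ctrOff 4 Lc)) Lc) (diagK (ctGen 3 α Lc κ' u))
              ((Φ Lc α).r (Sum.inl a) x) ((Φ Lc α).r (Sum.inl b) z) (Sum.inl a) (Sum.inl b))) := by
    intro α κ' u x z a b
    simp only [Φ_s_inl, Φ_r_inl]
    exact wilsonA_bref_inl_inl_conjV Lc α κ' u x z a b
  exact axisReflectionCovariant_flipK_TbalOf_JsBalBmNAtOf_ctrC_candidate hLc cE cVH cΛ W Cw δw hδw hW hWt h3S h4S γ hγ0 hγS C
    hCdef c' hc0 hcS' hWff (fun j => hE3ff j) X₂ hX₂ hEX₂ hWrC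

/-- [folklore] **THE `bhK`-UNIT INSTANCE `(cE, cVH) = (2, −Lc⁴)`** of `…_ctrC_wilson` (the field block of `bhK` is
`2·curl†curl`; an1's vh weight `−Lc^{d+1}`; cf. `S0NAtReflection.S0NAt_bref_two`): the same statement with the two units fixed
and NO normalisation hypothesis. -/
theorem axisReflectionCovariant_flipK_TbalOf_JsBalBmNAtOf_ctrC_wilson_two {Lc : ℕ} [NeZero Lc] (hLc : Odd Lc) (cΛ : ℝ)
    (W : ℕ → Fin 4 → (Fin 4 → ℤ) → Fin 4 → (Fin 4 → ℤ) → MKer 4 (Fib 3)) (Cw δw : ℕ → ℝ) (hδw : ∀ j, 0 < δw j)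
    (hW : ∀ j, VertexFamily₂ (W j) Lc (Cw j) (δw j))
    (hWt : ∀ (j : ℕ) (μ : Fin 4) (y : Fin 4 → ℤ) (ν : Fin 4) (y' t : Fin 4 → ℤ),
      W j μ (y + t) ν (y' + t) = shiftK (-((Lc : ℤ) • t)) (W j μ y ν y'))
    (h3S : ∀ j, comp (comp (coDressKBmAt (toSite (ctrOff 4 Lc)) Lc (KInvStep (d := 3) Lc (j + 1)))
      (bhKStepAt 3 (toSite (ctrOff 4 Lc)) Lc (j + 1))) (axEc (toSite (ctrOff 4 Lc)) Lc) = axEc (toSite (ctrOff 4 Lc)) Lc)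
    (h4S : ∀ j, comp (comp (axEc (toSite (ctrOff 4 Lc)) Lc) (bhKStepAt 3 (toSite (ctrOff 4 Lc)) Lc (j + 1)))
      (coDressKBmAt (toSite (ctrOff 4 Lc)) Lc (KInvStep (d := 3) Lc (j + 1))) = axEc (toSite (ctrOff 4 Lc)) Lc)
    (γ : ℕ → ℝ) (hγ0 : γ 0 = -((Lc : ℝ) ^ 4) / (Lc : ℝ) ^ 4)
    (hγS : ∀ j, γ (j + 1) = -((Lc : ℝ) ^ 4) * wVH 3 Lc (j + 1) / (stepScale 3 Lc (j + 1) * (Lc : ℝ) ^ 4))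
    (C : ℕ → Fin 4 → Fin 4 → (Fin 4 → ℤ) → MKer 4 (Fib 3)) (hCdef : ∀ j α κ' u, C j α κ' u = γ j • diagK (ctGen 3 α Lc κ' u))
    (c : ℕ → ℝ) (hcS : ∀ j, 2 * wE 3 Lc (j + 1) * c (j + 1) = γ (j + 1))
    (hE3ff : ∀ (j : ℕ) (α κ' : Fin 4) (u x z : Fin 4 → ℤ) (a b : Fin 4),
      e3NAtOf 3 Lc (toSite (ctrOff 4 Lc)) 2 (-((Lc : ℝ) ^ 4)) cΛ (j + 1) κ' (bref α κ' u) x z (Sum.inl a) (Sum.inl b) =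
        reflSign α κ' * ((Φ Lc α).s (Sum.inl a) * (Φ Lc α).s (Sum.inl b) *
          (e3NAtOf 3 Lc (toSite (ctrOff 4 Lc)) 2 (-((Lc : ℝ) ^ 4)) cΛ (j + 1) κ' u ((Φ Lc α).r (Sum.inl a) x)
              ((Φ Lc α).r (Sum.inl b) z) (Sum.inl a) (Sum.inl b) +
            c (j + 1) * conjV (bhKStepAt 3 (toSite (ctrOff 4 Lc)) Lc (j + 1)) (diagK (ctGen 3 α Lc κ' u))
              ((Φ Lc α).r (Sum.inl a) x) ((Φ Lc α).r (Sum.inl b) z) (Sum.inl a) (Sum.inl b))))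
    (X₂ : ℕ → Fin 4 → Fin 4 → (Fin 4 → ℤ) → Fin 4 → (Fin 4 → ℤ) → MKer 4 (Fib 3)) (hX₂ : ∀ j α μ y ν y', Loc (X₂ j α μ y ν y'))
    (hEX₂ : ∀ j α μ y ν y', comp (axEc (toSite (ctrOff 4 Lc)) Lc) (X₂ j α μ y ν y') = comp (X₂ j α μ y ν y') (axEc (toSite (ctrOff 4 Lc)) Lc))
    (hWrC : ∀ (j : ℕ) (α μ : Fin 4) (y : Fin 4 → ℤ) (ν : Fin 4) (y' : Fin 4 → ℤ),
      (JsBal0NAtOf (d := 3) hLc.pos (ctrOff_mem_box hLc.pos) 2 (-((Lc : ℝ) ^ 4)) cΛ W Cw δw hδw hW j).W μ (bref α μ y) ν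
          (bref α ν y') =
        (reflSign α μ * reflSign α ν) • refK (Φ Lc α)
          ((JsBal0NAtOf (d := 3) hLc.pos (ctrOff_mem_box hLc.pos) 2 (-((Lc : ℝ) ^ 4)) cΛ W Cw δw hδw hW j).W μ y ν y' +
            conjW (bhKStepAt 3 (toSite (ctrOff 4 Lc)) Lc j)
              (vertexOfK (coDressKBmAt (toSite (ctrOff 4 Lc)) Lc (KInvStep (d := 3) Lc j)) Lc
                (JsBal0NAtOf (d := 3) hLc.pos (ctrOff_mem_box hLc.pos) 2 (-((Lc : ℝ) ^ 4)) cΛ W Cw δw hδw hW j).S μ y)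
              (vertexOfK (coDressKBmAt (toSite (ctrOff 4 Lc)) Lc (KInvStep (d := 3) Lc j)) Lc
                (JsBal0NAtOf (d := 3) hLc.pos (ctrOff_mem_box hLc.pos) 2 (-((Lc : ℝ) ^ 4)) cΛ W Cw δw hδw hW j).S ν y')
              (vertexOfK (coDressKBmAt (toSite (ctrOff 4 Lc)) Lc (KInvStep (d := 3) Lc j)) Lc (C j α) μ y)
              (vertexOfK (coDressKBmAt (toSite (ctrOff 4 Lc)) Lc (KInvStep (d := 3) Lc j)) Lc (C j α) ν y') (X₂ j α μ y ν y'))) :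
    ∀ j : ℕ, AxisReflectionCovariant
      (flipK (TbalOf Lc (JsBalBmNAtOf (d := 3) hLc.pos (ctrOff_mem_box hLc.pos) 2 (-((Lc : ℝ) ^ 4)) cΛ W Cw δw hδw hW) j)) :=
  axisReflectionCovariant_flipK_TbalOf_JsBalBmNAtOf_ctrC_wilson hLc 2 (-((Lc : ℝ) ^ 4)) cΛ (by ring) W Cw δw hδw hW hWt h3S h4S
    γ hγ0 hγS C hCdef c hcS hE3ff X₂ hX₂ hEX₂ hWrC


/-! ## §2 The assembled root: (L1) and (L2) discharged -/

/-- [folklore] **`hR` FOR THE NATIVE BLOCK-MEAN-DRESSED SPINE, (L1) AND (L2) DISCHARGED**: reflection covariance of every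
`flipK (TbalOf Lc (JsBalBm♮_{ρ_c}) j)` on the normalisation hyperplane `2·cVH = −cE·Lc⁴` from EXACTLY the value-function ff-laws at
`j ≥ 1` (`hE3ff`, with successor contact coefficients `c (j+1)`, `hcS`) and the W-supplier's sockets (`hWt`, `X₂`, `hX₂`, `hEX₂`, `hWrC`).
Proof: `…_ctrC_wilson` with `h3S`/`h4S` := the two rules of `relInv_coDressKBmAt_KInvStep_succ_bhKStepAt`. -/
theorem axisReflectionCovariant_flipK_TbalOf_JsBalBmNAtOf_ctrC_assembled {Lc : ℕ} [NeZero Lc] (hLc : Odd Lc) (cE cVH cΛ : ℝ)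
    (hn : 2 * cVH = -(cE * (Lc : ℝ) ^ 4))
    (W : ℕ → Fin 4 → (Fin 4 → ℤ) → Fin 4 → (Fin 4 → ℤ) → MKer 4 (Fib 3)) (Cw δw : ℕ → ℝ) (hδw : ∀ j, 0 < δw j)
    (hW : ∀ j, VertexFamily₂ (W j) Lc (Cw j) (δw j))
    (hWt : ∀ (j : ℕ) (μ : Fin 4) (y : Fin 4 → ℤ) (ν : Fin 4) (y' t : Fin 4 → ℤ),
      W j μ (y + t) ν (y' + t) = shiftK (-((Lc : ℤ) • t)) (W j μ y ν y'))
    (γ : ℕ → ℝ) (hγ0 : γ 0 = cVH / (Lc : ℝ) ^ 4)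
    (hγS : ∀ j, γ (j + 1) = cVH * wVH 3 Lc (j + 1) / (stepScale 3 Lc (j + 1) * (Lc : ℝ) ^ 4))
    (C : ℕ → Fin 4 → Fin 4 → (Fin 4 → ℤ) → MKer 4 (Fib 3)) (hCdef : ∀ j α κ' u, C j α κ' u = γ j • diagK (ctGen 3 α Lc κ' u))
    (c : ℕ → ℝ) (hcS : ∀ j, cE * wE 3 Lc (j + 1) * c (j + 1) = γ (j + 1))
    (hE3ff : ∀ (j : ℕ) (α κ' : Fin 4) (u x z : Fin 4 → ℤ) (a b : Fin 4),
      e3NAtOf 3 Lc (toSite (ctrOff 4 Lc)) cE cVH cΛ (j + 1) κ' (bref α κ' u) x z (Sum.inl a) (Sum.inl b) =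
        reflSign α κ' * ((Φ Lc α).s (Sum.inl a) * (Φ Lc α).s (Sum.inl b) *
          (e3NAtOf 3 Lc (toSite (ctrOff 4 Lc)) cE cVH cΛ (j + 1) κ' u ((Φ Lc α).r (Sum.inl a) x) ((Φ Lc α).r (Sum.inl b) z)
              (Sum.inl a) (Sum.inl b) +
            c (j + 1) * conjV (bhKStepAt 3 (toSite (ctrOff 4 Lc)) Lc (j + 1)) (diagK (ctGen 3 α Lc κ' u))
              ((Φ Lc α).r (Sum.inl a) x) ((Φ Lc α).r (Sum.inl b) z) (Sum.inl a) (Sum.inl b))))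
    (X₂ : ℕ → Fin 4 → Fin 4 → (Fin 4 → ℤ) → Fin 4 → (Fin 4 → ℤ) → MKer 4 (Fib 3)) (hX₂ : ∀ j α μ y ν y', Loc (X₂ j α μ y ν y'))
    (hEX₂ : ∀ j α μ y ν y', comp (axEc (toSite (ctrOff 4 Lc)) Lc) (X₂ j α μ y ν y') = comp (X₂ j α μ y ν y') (axEc (toSite (ctrOff 4 Lc)) Lc))
    (hWrC : ∀ (j : ℕ) (α μ : Fin 4) (y : Fin 4 → ℤ) (ν : Fin 4) (y' : Fin 4 → ℤ),
      (JsBal0NAtOf (d := 3) hLc.pos (ctrOff_mem_box hLc.pos) cE cVH cΛ W Cw δw hδw hW j).W μ (bref α μ y) ν (bref α ν y') =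
        (reflSign α μ * reflSign α ν) • refK (Φ Lc α)
          ((JsBal0NAtOf (d := 3) hLc.pos (ctrOff_mem_box hLc.pos) cE cVH cΛ W Cw δw hδw hW j).W μ y ν y' +
            conjW (bhKStepAt 3 (toSite (ctrOff 4 Lc)) Lc j)
              (vertexOfK (coDressKBmAt (toSite (ctrOff 4 Lc)) Lc (KInvStep (d := 3) Lc j)) Lc
                (JsBal0NAtOf (d := 3) hLc.pos (ctrOff_mem_box hLc.pos) cE cVH cΛ W Cw δw hδw hW j).S μ y)
              (vertexOfK (coDressKBmAt (toSite (ctrOff 4 Lc)) Lc (KInvStep (d := 3) Lc j)) Lc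
                (JsBal0NAtOf (d := 3) hLc.pos (ctrOff_mem_box hLc.pos) cE cVH cΛ W Cw δw hδw hW j).S ν y')
              (vertexOfK (coDressKBmAt (toSite (ctrOff 4 Lc)) Lc (KInvStep (d := 3) Lc j)) Lc (C j α) μ y)
              (vertexOfK (coDressKBmAt (toSite (ctrOff 4 Lc)) Lc (KInvStep (d := 3) Lc j)) Lc (C j α) ν y') (X₂ j α μ y ν y'))) :
    ∀ j : ℕ, AxisReflectionCovariant
      (flipK (TbalOf Lc (JsBalBmNAtOf (d := 3) hLc.pos (ctrOff_mem_box hLc.pos) cE cVH cΛ W Cw δw hδw hW) j)) :=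
  axisReflectionCovariant_flipK_TbalOf_JsBalBmNAtOf_ctrC_wilson hLc cE cVH cΛ hn W Cw δw hδw hW hWt
    (fun j => (relInv_coDressKBmAt_KInvStep_succ_bhKStepAt (d := 3) (ctrOff_mem_box (one_le_of_neZero Lc)) j).AME)
    (fun j => (relInv_coDressKBmAt_KInvStep_succ_bhKStepAt (d := 3) (ctrOff_mem_box (one_le_of_neZero Lc)) j).EMA)
    γ hγ0 hγS C hCdef c hcS hE3ff X₂ hX₂ hEX₂ hWrC

/-- [folklore] **THE `bhK`-UNIT INSTANCE `(cE, cVH) = (2, −Lc⁴)` OF THE ASSEMBLED ROOT** — no normalisation hypothesis, no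
rules 3–4, no Wilson law: what is left of `hR` for this family is (L3) + (L4). -/
theorem axisReflectionCovariant_flipK_TbalOf_JsBalBmNAtOf_ctrC_assembled_two {Lc : ℕ} [NeZero Lc] (hLc : Odd Lc) (cΛ : ℝ)
    (W : ℕ → Fin 4 → (Fin 4 → ℤ) → Fin 4 → (Fin 4 → ℤ) → MKer 4 (Fib 3)) (Cw δw : ℕ → ℝ) (hδw : ∀ j, 0 < δw j)
    (hW : ∀ j, VertexFamily₂ (W j) Lc (Cw j) (δw j))
    (hWt : ∀ (j : ℕ) (μ : Fin 4) (y : Fin 4 → ℤ) (ν : Fin 4) (y' t : Fin 4 → ℤ),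
      W j μ (y + t) ν (y' + t) = shiftK (-((Lc : ℤ) • t)) (W j μ y ν y'))
    (γ : ℕ → ℝ) (hγ0 : γ 0 = -((Lc : ℝ) ^ 4) / (Lc : ℝ) ^ 4)
    (hγS : ∀ j, γ (j + 1) = -((Lc : ℝ) ^ 4) * wVH 3 Lc (j + 1) / (stepScale 3 Lc (j + 1) * (Lc : ℝ) ^ 4))
    (C : ℕ → Fin 4 → Fin 4 → (Fin 4 → ℤ) → MKer 4 (Fib 3)) (hCdef : ∀ j α κ' u, C j α κ' u = γ j • diagK (ctGen 3 α Lc κ' u))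
    (c : ℕ → ℝ) (hcS : ∀ j, 2 * wE 3 Lc (j + 1) * c (j + 1) = γ (j + 1))
    (hE3ff : ∀ (j : ℕ) (α κ' : Fin 4) (u x z : Fin 4 → ℤ) (a b : Fin 4),
      e3NAtOf 3 Lc (toSite (ctrOff 4 Lc)) 2 (-((Lc : ℝ) ^ 4)) cΛ (j + 1) κ' (bref α κ' u) x z (Sum.inl a) (Sum.inl b) =
        reflSign α κ' * ((Φ Lc α).s (Sum.inl a) * (Φ Lc α).s (Sum.inl b) *
          (e3NAtOf 3 Lc (toSite (ctrOff 4 Lc)) 2 (-((Lc : ℝ) ^ 4)) cΛ (j + 1) κ' u ((Φ Lc α).r (Sum.inl a) x)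
              ((Φ Lc α).r (Sum.inl b) z) (Sum.inl a) (Sum.inl b) +
            c (j + 1) * conjV (bhKStepAt 3 (toSite (ctrOff 4 Lc)) Lc (j + 1)) (diagK (ctGen 3 α Lc κ' u))
              ((Φ Lc α).r (Sum.inl a) x) ((Φ Lc α).r (Sum.inl b) z) (Sum.inl a) (Sum.inl b))))
    (X₂ : ℕ → Fin 4 → Fin 4 → (Fin 4 → ℤ) → Fin 4 → (Fin 4 → ℤ) → MKer 4 (Fib 3)) (hX₂ : ∀ j α μ y ν y', Loc (X₂ j α μ y ν y'))
    (hEX₂ : ∀ j α μ y ν y', comp (axEc (toSite (ctrOff 4 Lc)) Lc) (X₂ j α μ y ν y') = comp (X₂ j α μ y ν y') (axEc (toSite (ctrOff 4 Lc)) Lc))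
    (hWrC : ∀ (j : ℕ) (α μ : Fin 4) (y : Fin 4 → ℤ) (ν : Fin 4) (y' : Fin 4 → ℤ),
      (JsBal0NAtOf (d := 3) hLc.pos (ctrOff_mem_box hLc.pos) 2 (-((Lc : ℝ) ^ 4)) cΛ W Cw δw hδw hW j).W μ (bref α μ y) ν
          (bref α ν y') =
        (reflSign α μ * reflSign α ν) • refK (Φ Lc α)
          ((JsBal0NAtOf (d := 3) hLc.pos (ctrOff_mem_box hLc.pos) 2 (-((Lc : ℝ) ^ 4)) cΛ W Cw δw hδw hW j).W μ y ν y' +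
            conjW (bhKStepAt 3 (toSite (ctrOff 4 Lc)) Lc j)
              (vertexOfK (coDressKBmAt (toSite (ctrOff 4 Lc)) Lc (KInvStep (d := 3) Lc j)) Lc
                (JsBal0NAtOf (d := 3) hLc.pos (ctrOff_mem_box hLc.pos) 2 (-((Lc : ℝ) ^ 4)) cΛ W Cw δw hδw hW j).S μ y)
              (vertexOfK (coDressKBmAt (toSite (ctrOff 4 Lc)) Lc (KInvStep (d := 3) Lc j)) Lc
                (JsBal0NAtOf (d := 3) hLc.pos (ctrOff_mem_box hLc.pos) 2 (-((Lc : ℝ) ^ 4)) cΛ W Cw δw hδw hW j).S ν y')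
              (vertexOfK (coDressKBmAt (toSite (ctrOff 4 Lc)) Lc (KInvStep (d := 3) Lc j)) Lc (C j α) μ y)
              (vertexOfK (coDressKBmAt (toSite (ctrOff 4 Lc)) Lc (KInvStep (d := 3) Lc j)) Lc (C j α) ν y') (X₂ j α μ y ν y'))) :
    ∀ j : ℕ, AxisReflectionCovariant
      (flipK (TbalOf Lc (JsBalBmNAtOf (d := 3) hLc.pos (ctrOff_mem_box hLc.pos) 2 (-((Lc : ℝ) ^ 4)) cΛ W Cw δw hδw hW) j)) :=
  axisReflectionCovariant_flipK_TbalOf_JsBalBmNAtOf_ctrC_assembled hLc 2 (-((Lc : ℝ) ^ 4)) cΛ (by ring) W Cw δw hδw hW hWt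
    γ hγ0 hγS C hCdef c hcS hE3ff X₂ hX₂ hEX₂ hWrC

end

end Summit.QuantumFields.BalabanUV.Beta.SpineRooted
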